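import Mathlib
import Summits.MatrixMultiplication.MatrixMultiplication.Theses.ThinBlockAlpha
import Summits.MatrixMultiplication.MatrixMultiplication.Theorems.ThinBlockAlphaRectangularThmBChartSTPP
import Summits.MatrixMultiplication.MatrixMultiplication.Theorems.ThinBlockAlphaRectangularThmBGrowth
import Summits.MatrixMultiplication.MatrixMultiplication.Theorems.RectangularThmB.Negative.NullChart
import Summits.MatrixMultiplication.MatrixMultiplication.Theorems.RectangularThmB.Negative.NullChartEntropy
import Literature.Computability.AlgebraicComplexity.LaserMethodTypeCount

/-!
# `BoundedExponentTwoSevenths` (stmt-MatrixMultiplication-15152, route ThinBlockAlpha): PROVED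

`boundedExponentTwoSevenths_proof : ThinBlockAlpha.BoundedExponentTwoSevenths` — the first closed rung
of the bet `BoundedThinPackings`: with the exponent bound `ℓ = 9`, for every `η > 0` the abelian group
`(ℤ/9)^{18m}` (`m = m(η)` large) carries an STPP family of `L` blocks `⟨7^{7m}, 7^{2m}, 7^{7m}⟩`
(`N = 7^{7m} ≥ 2`, `M = 7^{2m} = N^{2/7}`) with `|H| = 9^{18m} ≤ L · N^{2+η}`.

The family is the null-offset CKSU chart over `ℤ/9` fed to the tree's hashing / type-count theorem
(`exists_free_diagonal_jointType_card`, `Literature…LaserMethodTypeCount`), exactly the construction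
that refuted the route's ex-item `RectangularThmB` (Theorems/ThinBlockAlphaRectangularThmBRefutation.lean,
`exists_thin_family`, p84448).  That module ends with `not_RectangularThmB : ¬ RectangularThmB`, a
constant the route file no longer renders (rev 6), so it cannot be imported here; following the
planner's note we import only its four sorry-free helper modules (chart STPP theorem `stub_chartSTPP` =
CKSU Thm 37; growth lemma `stub_growth`; chart data / finite facts `nullChart_facts`,
`exponent_pi_zmod9_le`; entropy data `nullChart_entropy`) and re-run the assembly as
`twoSevenths_thin_family` (proof text identical to `exists_thin_family`).

Symbols `a = (F, {0}, {1})`, `b = ({0}, ℤ/9 ∖ {0,8}, {0})`, `c = ({0}, {0}, F)`, `o = ({0}, {0}, {1})`,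
`F = ℤ/9 ∖ {0,1}`; joint type `(7m, 2m, 7m, 2m)` on `n = 18m` coordinates; the free diagonal `Δ`
returned by the hashing theorem has `|Δ| ≥ 2^{n h₀ − o(n)}`, `h₀ = log₂ 9 − (7/9) log₂ 7`, and
`2^{18 m h₀} · 7^{14 m} = 9^{18 m}` exactly, so the packing is tight up to the subexponential hashing
loss, which `stub_growth` puts below `N^η`.

Sources: H. Cohn, R. Kleinberg, B. Szegedy, C. Umans, FOCS 2005, arXiv:math/0511460, §6 (Def. 36,
Thm. 37); J. Blasiak, T. Church, H. Cohn, J. Grochow, E. Naslund, W. Sawin, C. Umans, Discrete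
Analysis 2017:3, arXiv:1605.06702 (Thm B — the square barrier this thin family sidesteps).
-/

-- `Summit.<Summit>.<Problem>` is the tree's mandated summit-side namespace; for this
-- single-conjunct summit the two coincide, so the file silences `dupNamespace`.
set_option linter.dupNamespace false

noncomputable section

open Finset

namespace Summit.MatrixMultiplication.MatrixMultiplication.Theorems

open Literature.Computability.AlgebraicComplexity
open Summit.MatrixMultiplication.MatrixMultiplication.Theorems.RectangularThmB.Negative

/-! ### The thin family over `(ℤ/9)^{18m}` -/

/-- **The thin family** (null-offset chart over `ℤ/9` + hashing; same statement and proof as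
`exists_thin_family` of Theorems/ThinBlockAlphaRectangularThmBRefutation.lean). For `η` and `m ≥ 1`
large enough that the hashing loss is below `(7^{7m})^η` (`stub_growth`), there is an STPP family in
`(ℤ/9)^{18m}` of `L` blocks `⟨7^{7m}, 7^{2m}, 7^{7m}⟩` with `9^{18m} ≤ L · (7^{7m})^{2+η}`
(CKSU 2005 Def. 36 / Thm. 37 via `stub_chartSTPP`, hashing via `exists_free_diagonal_jointType_card`). -/
theorem twoSevenths_thin_family (η : ℝ) (m : ℕ) (hm : 1 ≤ m)
    (hgrowth : (((18 * m : ℕ) : ℝ) + 1) ^ 31 * 96 *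
        Real.exp (4 * Real.sqrt (Real.log 3 + ((18 * m : ℕ) : ℝ) * Real.log 12))
      < ((7 : ℝ) ^ (7 * m)) ^ η) :
    ∃ (L : ℕ) (A B C : Fin L → Finset (Fin (18 * m) → ZMod 9)), IsSTPP A B C ∧
      (∀ i, (A i).card = 7 ^ (7 * m) ∧ (B i).card = 7 ^ (2 * m) ∧ (C i).card = 7 ^ (7 * m)) ∧
      (9 : ℝ) ^ (18 * m) ≤ (L : ℝ) * ((7 : ℝ) ^ (7 * m)) ^ (2 + η) := by
  classical
  set N : ℕ := 18 * m with hNdef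
  have hN : 0 < N := by omega
  -- the hashing theorem
  obtain ⟨Δ, hΔQ, hfree, hsize⟩ := exists_free_diagonal_jointType_card nullS labα labβ labγ
    labα_injective labβ_injective labγ_injective (b := 1)
    (fun i ρ => by simp only [labα]; split_ifs <;> simp)
    (fun j ρ => by simp only [labβ]; split_ifs <;> simp)
    lab_tight hN (nullQ m) (fun s hs => nullQ_eq_zero_of_not_mem m s hs) (sum_nullQ m) nullP
    (nullP_eq_div m hm)
  -- every coordinate of a member of `Δ` is a profile in `S`
  have hmemS : ∀ δ ∈ Δ, ∀ ρ, labelSeq δ ρ ∈ nullS := by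
    intro δ hδ ρ
    have hQ : letterCount (labelSeq δ) = nullQ m := (Finset.mem_filter.1 (hΔQ hδ)).2
    by_contra hρ
    have h0 := nullQ_eq_zero_of_not_mem m _ hρ
    rw [← hQ] at h0
    exact (letterCount_pos_of_apply (labelSeq δ) ρ).ne' h0
  -- reading a profile in `S` as a symbol (inverse of `(prof₁, prof₂, prof₃)` on `S`, junk elsewhere)
  let symOf : Fin 2 × Fin 2 × Fin 3 → Fin 4 := fun p =>
    if p = (0, 1, 1) then 1 else if p = (1, 1, 0) then 2 else if p = (1, 0, 2) then 3 else 0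
  have symOf_prof : ∀ x : Fin 4, symOf (prof₁ x, prof₂ x, prof₃ x) = x := by decide
  have prof_symOf : ∀ p ∈ nullS, (prof₁ (symOf p), prof₂ (symOf p), prof₃ (symOf p)) = p := by
    decide
  have letterCount_symOf : ∀ (w : Fin N → Fin 2 × Fin 2 × Fin 3), (∀ c, w c ∈ nullS) →
      ∀ x : Fin 4, letterCount (fun c => symOf (w c)) x = letterCount w (prof₁ x, prof₂ x, prof₃ x) := by
    intro w hw x
    simp only [letterCount_apply]
    congr 1
    ext c
    simp only [Finset.mem_filter, Finset.mem_univ, true_and]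
    constructor
    · intro h
      rw [← h, prof_symOf _ (hw c)]
    · intro h
      rw [h, symOf_prof]
  -- enumerate `Δ` and read off the rows
  set L : ℕ := Δ.card with hLdef
  let e : Fin L ≃ {x // x ∈ Δ} := Δ.equivFin.symm
  let d : Fin L → (Fin N → Fin 2) × (Fin N → Fin 2) × (Fin N → Fin 3) := fun i => (e i).1
  have hd : ∀ i, d i ∈ Δ := fun i => (e i).2
  have hdinj : Function.Injective d := fun i i' h => e.injective (Subtype.ext h)
  let row : Fin L → Fin N → Fin 4 := fun i ρ => symOf (labelSeq (d i) ρ)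
  have hprof : ∀ i ρ, (prof₁ (row i ρ), prof₂ (row i ρ), prof₃ (row i ρ)) = labelSeq (d i) ρ :=
    fun i ρ => prof_symOf _ (hmemS _ (hd i) ρ)
  have hprof₁ : ∀ i ρ, prof₁ (row i ρ) = (d i).1 ρ := fun i ρ => congrArg Prod.fst (hprof i ρ)
  have hprof₂ : ∀ i ρ, prof₂ (row i ρ) = (d i).2.1 ρ := fun i ρ =>
    congrArg (fun p => p.2.1) (hprof i ρ)
  have hprof₃ : ∀ i ρ, prof₃ (row i ρ) = (d i).2.2 ρ := fun i ρ =>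
    congrArg (fun p => p.2.2) (hprof i ρ)
  -- all rows have the same type
  have htype : ∀ i x, letterCount (row i) x = nullQ m (prof₁ x, prof₂ x, prof₃ x) := by
    intro i x
    have hQ : letterCount (labelSeq (d i)) = nullQ m := (Finset.mem_filter.1 (hΔQ (hd i))).2
    rw [← hQ]
    exact letterCount_symOf _ (hmemS _ (hd i)) x
  -- the local chart-USP property
  have hUSP : IsLocalChartUSP nullA nullB nullC row := by
    intro i j k hne
    by_contra hall
    push Not at hall
    -- all coordinates solvable ⇒ all Farkas values zero ⇒ all profiles in S ⇒ freeness
    have hg : ∀ c, 0 ≤ farkas₁ (row i c) + farkas₂ (row j c) + farkas₃ (row k c) ∧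
        (farkas₁ (row i c) + farkas₂ (row j c) + farkas₃ (row k c) = 0 →
          (prof₁ (row i c), prof₂ (row j c), prof₃ (row k c)) ∈ nullS) :=
      fun c => nullChart_facts.2 _ _ _ (hall c)
    have hsum : ∑ c, (farkas₁ (row i c) + farkas₂ (row j c) + farkas₃ (row k c)) = 0 := by
      rw [Finset.sum_add_distrib, Finset.sum_add_distrib, sum_apply_eq_sum_letterCount,
        sum_apply_eq_sum_letterCount, sum_apply_eq_sum_letterCount, ← Finset.sum_add_distrib,
        ← Finset.sum_add_distrib]
      refine Finset.sum_eq_zero fun x _ => ?_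
      rw [htype i, htype j, htype k, ← mul_add, ← mul_add, farkas_sum_symbol, mul_zero]
    have hzero : ∀ c, farkas₁ (row i c) + farkas₂ (row j c) + farkas₃ (row k c) = 0 := by
      intro c
      exact (Finset.sum_eq_zero_iff_of_nonneg (fun c _ => (hg c).1)).1 hsum c (Finset.mem_univ c)
    have hS : ∀ c, ((d i).1 c, (d j).2.1 c, (d k).2.2 c) ∈ nullS := by
      intro c
      rw [← hprof₁, ← hprof₂, ← hprof₃]
      exact (hg c).2 (hzero c)
    obtain ⟨hij, hjk⟩ := hfree (d i) (hd i) (d j) (hd j) (d k) (hd k) hS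
    exact hne.elim (fun h => h (hdinj hij)) (fun h => h (hdinj hjk))
  -- the STPP family
  refine ⟨L, fun i => Fintype.piFinset fun c => nullA (row i c),
    fun i => Fintype.piFinset fun c => nullB (row i c),
    fun i => Fintype.piFinset fun c => nullC (row i c),
    stub_chartSTPP _ _ nullA nullB nullC nullChart_facts.1 N L row hUSP, ?_, ?_⟩
  · -- cardinalities
    intro i
    have e0 : nullQ m (prof₁ 0, prof₂ 0, prof₃ 0) = 7 * m := by
      simp [nullQ, prof₁, prof₂, prof₃]
    have e1 : nullQ m (prof₁ 1, prof₂ 1, prof₃ 1) = 2 * m := by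
      simp [nullQ, prof₁, prof₂, prof₃]
    have e2 : nullQ m (prof₁ 2, prof₂ 2, prof₃ 2) = 7 * m := by
      simp [nullQ, prof₁, prof₂, prof₃]
    have cA0 : (nullA 0).card = 7 := by decide
    have cA1 : (nullA 1).card = 1 := by decide
    have cA2 : (nullA 2).card = 1 := by decide
    have cA3 : (nullA 3).card = 1 := by decide
    have cB0 : (nullB 0).card = 1 := by decide
    have cB1 : (nullB 1).card = 7 := by decide
    have cB2 : (nullB 2).card = 1 := by decide
    have cB3 : (nullB 3).card = 1 := by decide
    have cC0 : (nullC 0).card = 1 := by decide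
    have cC1 : (nullC 1).card = 1 := by decide
    have cC2 : (nullC 2).card = 7 := by decide
    have cC3 : (nullC 3).card = 1 := by decide
    refine ⟨?_, ?_, ?_⟩
    · rw [Fintype.card_piFinset, prod_apply_eq_prod_pow_letterCount (fun x => (nullA x).card) (row i),
        Fin.prod_univ_four, cA0, cA1, cA2, cA3, one_pow, one_pow, one_pow, mul_one, mul_one, mul_one,
        htype i 0, e0]
    · rw [Fintype.card_piFinset, prod_apply_eq_prod_pow_letterCount (fun x => (nullB x).card) (row i),
        Fin.prod_univ_four, cB0, cB1, cB2, cB3, one_pow, one_pow, one_pow, mul_one, mul_one, one_mul,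
        htype i 1, e1]
    · rw [Fintype.card_piFinset, prod_apply_eq_prod_pow_letterCount (fun x => (nullC x).card) (row i),
        Fin.prod_univ_four, cC0, cC1, cC2, cC3, one_pow, one_pow, one_pow, mul_one, one_mul, one_mul,
        htype i 2, e2]
  · -- the size bound
    obtain ⟨h1, h2, h3, hpen⟩ := nullChart_entropy
    set h₀ : ℝ := Real.logb 2 9 - 7 / 9 * Real.logb 2 7 with hh₀
    set X : ℝ := (((18 * m : ℕ) : ℝ) + 1) ^ 31 * 96 *
        Real.exp (4 * Real.sqrt (Real.log 3 + ((18 * m : ℕ) : ℝ) * Real.log 12)) with hX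
    -- clean up the right-hand side of the hashing bound
    have hsize' : (2 : ℝ) ^ ((N : ℝ) * h₀) ≤ (L : ℝ) * X := by
      refine le_trans ?_ (le_trans hsize (le_of_eq ?_))
      · apply Real.rpow_le_rpow_of_exponent_le (by norm_num)
        apply mul_le_mul_of_nonneg_left _ (Nat.cast_nonneg N)
        have := le_min h1 (le_min h2 h3)
        linarith
      · rw [hX, hNdef]
        simp only [Fintype.card_prod, Fintype.card_fin, max_self, Nat.cast_one, mul_one,
          Nat.cast_ofNat, Nat.cast_mul]
        norm_num
    -- the exact tiling identity `2^{N h₀} · 7^{14m} = 9^{18m}`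
    have hident : (2 : ℝ) ^ ((N : ℝ) * h₀) * (7 : ℝ) ^ (14 * m) = (9 : ℝ) ^ (18 * m) := by
      have e : (N : ℝ) * h₀ = Real.logb 2 9 * (18 * m : ℕ) - Real.logb 2 7 * (14 * m : ℕ) := by
        rw [hh₀, hNdef]; push_cast; ring
      rw [e, Real.rpow_sub two_pos, Real.rpow_mul_natCast (by norm_num : (0:ℝ) ≤ 2),
        Real.rpow_mul_natCast (by norm_num : (0:ℝ) ≤ 2),
        Real.rpow_logb two_pos (by norm_num) (by norm_num),
        Real.rpow_logb two_pos (by norm_num) (by norm_num)]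
      exact div_mul_cancel₀ _ (by positivity)
    -- `L > 0`
    have hLpos : (0 : ℝ) < L := by
      have h2pos : (0 : ℝ) < (2 : ℝ) ^ ((N : ℝ) * h₀) := Real.rpow_pos_of_pos two_pos _
      have hXpos : 0 < X := by rw [hX]; positivity
      by_contra hle
      have hL0 : (L : ℝ) ≤ 0 := le_of_not_gt hle
      nlinarith [hsize']
    -- assemble
    have hsplit : ((7 : ℝ) ^ (7 * m)) ^ (2 + η) = (7 : ℝ) ^ (14 * m) * ((7 : ℝ) ^ (7 * m)) ^ η := by
      rw [Real.rpow_add (by positivity), Real.rpow_two, ← pow_mul]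
      ring_nf
    rw [hsplit, ← hident]
    have h7pos : (0 : ℝ) < (7 : ℝ) ^ (14 * m) := by positivity
    calc (2 : ℝ) ^ ((N : ℝ) * h₀) * (7 : ℝ) ^ (14 * m)
        ≤ (L : ℝ) * X * (7 : ℝ) ^ (14 * m) := mul_le_mul_of_nonneg_right hsize' h7pos.le
      _ ≤ (L : ℝ) * ((7 : ℝ) ^ (7 * m)) ^ η * (7 : ℝ) ^ (14 * m) := by
          apply mul_le_mul_of_nonneg_right _ h7pos.le
          exact mul_le_mul_of_nonneg_left hgrowth.le hLpos.le
      _ = (L : ℝ) * ((7 : ℝ) ^ (14 * m) * ((7 : ℝ) ^ (7 * m)) ^ η) := by ring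

/-! ### The route item -/

/-- **`BoundedExponentTwoSevenths` holds** (route ThinBlockAlpha, item stmt-MatrixMultiplication-15152):
with exponent bound `ℓ = 9`, for every `η > 0` the group `(ℤ/9)^{18m}` (`m = m(η)` from `stub_growth`)
carries an STPP family of `L` blocks `⟨N, M, N⟩ = ⟨7^{7m}, 7^{2m}, 7^{7m}⟩`, `N ≥ 2`, `N^{2/7} = M`,
`|H| = 9^{18m} ≤ L · N^{2+η}` — the `a = 2/7` instance of the bet `BoundedThinPackings`. -/
theorem boundedExponentTwoSevenths_proof :
    Summit.MatrixMultiplication.MatrixMultiplication.Theses.ThinBlockAlpha.BoundedExponentTwoSevenths := by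
  unfold Summit.MatrixMultiplication.MatrixMultiplication.Theses.ThinBlockAlpha.BoundedExponentTwoSevenths
  refine ⟨9, fun η hη => ?_⟩
  obtain ⟨m, hm, hgrowth⟩ := stub_growth η hη
  obtain ⟨L, A, B, C, hS, hc, hbig⟩ := twoSevenths_thin_family η m hm hgrowth
  refine ⟨(Fin (18 * m) → ZMod 9), inferInstance, inferInstance, L, 7 ^ (7 * m), 7 ^ (2 * m), A, B, C,
    exponent_pi_zmod9_le _, hS, hc, ?_, ?_, ?_⟩
  · -- `2 ≤ N`
    exact le_trans (by norm_num : 2 ≤ 7 ^ 1) (Nat.pow_le_pow_right (by norm_num) (by omega))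
  · -- `N^{2/7} ≤ M` (with equality)
    push_cast
    rw [← Real.rpow_natCast (7 : ℝ) (7 * m), ← Real.rpow_mul (by norm_num),
      ← Real.rpow_natCast (7 : ℝ) (2 * m)]
    apply le_of_eq
    congr 1
    push_cast
    ring
  · -- `|H| = 9^{18m} ≤ L · N^{2+η}`
    have hH : (Fintype.card (Fin (18 * m) → ZMod 9) : ℝ) = (9 : ℝ) ^ (18 * m) := by
      rw [Fintype.card_fun, ZMod.card, Fintype.card_fin]; push_cast; ring
    rw [hH]
    push_cast
    exact hbig

end Summit.MatrixMultiplication.MatrixMultiplication.Theorems
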